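import Literature.Geometry.Kaehler.ComplexTorusWeilTypeUnitaryGroup
import HarnessLib

/-!
# `G_div(X) = Gl_B(V) ∩ Sp(V, φ)` is the largest subgroup leaving all divisor classes invariant
# (Moonen–Zarhin 1998, (10))

Layer `Literature/Geometry/Kaehler`, namespace `Literature.Geometry.Kaehler.ComplexTorus`; lane
`lit-hodgefound` (Track 2 foundations library), Layer A4, self-proposed row «Q143⁺ · Q72⁺ · A2-31⁺ · (#2)⁺ —
Moonen–Zarhin 1998 (10): the group `G_div(X) = Gl_B(V) ∩ Sp(V, φ)` is the largest subgroup of `Gl(V)`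
leaving all divisor classes invariant; the divisor classes are the forms `φ_s`, `s ∈ S_λ`; `G_div(X)` does
not depend on `λ`» of `run/shared/lean/pub/lit-hodgefound/SKELETON.md`. Sequel of `ComplexTorusHodgeGroup.lean`
(Q72: `Sp(V, E)(ℝ) = spGroup Φ η`, `mem_spGroup_iff_latticeGram`, algebraic `ℚ`-subgroups through their
equations `IsRatAlgSubgroupEqs`, `centralizerEqs`), `ComplexTorusLefschetzGroup.lean` (Q143: `lefschetzGroup Φ η
= Lf(X)(ℝ) = Sp(V, E)(ℝ) ∩ C(End_ℚ X)(ℝ)`, `endCentralizer`), `ComplexTorusNeronSeveriEndomorphisms.lean`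
(A2-31: `NS_ℚ(X) = neronSeveriQ Φ`, the rational Gram matrix `ratGram`, the `†`-symmetric elements
`End^s_ℚ(X) = symmEndRat Φ G₀`, Prop. 2.4.12 `φ : NS_ℚ(X) ≅ End^s_ℚ(X)`, `nsToEnd Φ G₀ : L ↦ G₀⁻¹ G_L`, and
Lefschetz `(1,1)`: `map_ofRealFormₗ_neronSeveriQ : NS_ℚ(X) ↠ H²_Hodge(X)`) and
`ComplexTorusWeilTypeUnitaryGroup.lean` (row #2 FILE A: the pointwise stabiliser `formsStabilizer Φ S`, the
centraliser `matCentralizer A = R(ℝ)`). CONCRETE torus level, model-free: `X = E/Φ(ℤ^ι)`,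
`V_ℝ = H₁(X, ℝ) = ℝ^ι` (lattice basis), groups through their REAL POINTS inside `SL_ι(ℝ) = SL(V_ℝ)`,
`H²(X, ℂ) = Alt²_ℝ(E; ℂ)` with `M` acting by pull-back along `ρ(M) = Φ M Φ⁻¹` (`analyticRepReal Φ Φ M`); the
divisor classes are `H²_Hodge(X) = hodgeClasses Φ 1 = NS_ℚ(X)` (Lefschetz `(1,1)`).

## Source, verbatim

B. J. J. Moonen, Yu. G. Zarhin, *Weil classes on abelian varieties*, J. reine angew. Math. 496 (1998) 83–92,
held `paper:arxiv-alg-geom_9612017`, paragraph (10) of the arXiv numbering (p. 2, L53–L71): "Choose a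
polarization `λ` of `X`, and write `α ↦ α†` for the associated Rosati involution of `End⁰(X) ≅ M_m(D)`. Let
`S_λ ⊆ End⁰(X)` be the set of `†`-symmetric elements. We define the algebra `B ⊆ End⁰(X)` as the
`ℚ`-subalgebra generated by `S_λ`. […] Let `φ = φ_X : V × V → ℚ` be the nondegenerate alternating bilinear
form associated to `λ`. We define the algebraic group `G_div(X) ⊆ Sp(V, φ)` as the centralizer of `B` in
`Sp(V, φ)`. More precisely, `G_div(X) := Gl_B(V) ∩ Sp(V, φ)`. Of course, the main motivation for introducing
this group `G_div(X)` is the fact that it is the largest algebraic subgroup of `Gl(V)` defined over `ℚ`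
which leaves invariant all divisor classes in `H²(X, ℚ) = ⋀²V`. In fact, the divisor classes, viewed as
alternating bilinear forms on `V`, are precisely the forms `φ_s : (v₁, v₂) ↦ φ(s·v₁, v₂)` for `s ∈ S_λ`.
The group `G_div(X)` does not depend on the choice of `λ`."

## Rendering (one definition with body, theorems proved; no named fact, net debt 0)

`(X, L₀)`: `E₀ = η₀` a `2`-form of type `(1,1)` with RATIONAL, INVERTIBLE Gram matrix `G₀` on the lattice
basis — the hypotheses `(h₀, hG₀, hdet)` of A2-31's `nsEquivSymmEnd`, discharged for every Riemann form
(`IsRiemannForm.exists_ratMatrix_latticeGram_isUnit`); `S_λ = symmEndRat Φ G₀` (`G₀ = ratGram Φ η₀`);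
centralising the generators `S_λ` of `B` is centralising `B`, so `Gl_B(V)(ℝ) ∩ SL = ⋂_{s ∈ S_λ} matCentralizer s`.
* **`divisorClassGroup Φ η₀ := spGroup Φ η₀ ⊓ ⨅ s ∈ S_λ, matCentralizer s = G_div(X)(ℝ)`**
  (`⊆ Sp(V, φ)(ℝ) ⊆ SL(V_ℝ)`); `mem_divisorClassGroup_iff`.
* `compContinuousLinearMap_ofRealForm_eq_iff` (`M` fixes the class `E ∈ H²(X, ℝ)` iff `M ∈ Sp(V, E)(ℝ)`),
  `formsStabilizer_hodgeClasses_one_eq_iInf_spGroup` (the stabiliser of all divisor classes is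
  `⋂_{E ∈ NS_ℚ(X)} Sp(V, E)(ℝ)` — Lefschetz `(1,1)`).
* "the divisor classes … are precisely the forms `φ_s`": `latticeGram_eq_mul_nsToEnd` (`G_L = G₀ φ(L)`),
  **`apply_eq_apply_analyticRepReal_nsToEnd`** (`E_L(u, v) = E₀(u, ρ(φ(L)) v)`) and
  **`apply_eq_apply_analyticRepReal_nsToEnd_left`** (`E_L(u, v) = E₀(ρ(φ(L)) u, v)`, `†`-symmetry), with
  `φ(L)` running over ALL of `S_λ` by A2-31 `exists_nsToEnd_eq`.
* MAIN **`formsStabilizer_hodgeClasses_one_eq_divisorClassGroup`**: the pointwise stabiliser in `SL(V_ℝ)` of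
  the divisor classes `H²_Hodge(X)` IS `G_div(X)(ℝ)` ("the largest algebraic subgroup … which leaves
  invariant all divisor classes"); `divisorClassGroup_eq` ("does not depend on the choice of `λ`");
  "defined over `ℚ`": `divisorClassEqs`, `divisorClassGroup_eq_realPoints`.
* `divisorClassGroup_le_spGroup`, **`lefschetzGroup_le_divisorClassGroup`** (`Lf(X) ⊆ G_div(X)`: `Lf`
  centralises all of `End_ℚ(X) ⊇ S_λ`), **`hodgeGroup_le_divisorClassGroup`** (`Hg(X) ⊆ G_div(X)`: `Hg`
  fixes the Hodge classes, Thm. 7.2.4 Step I), and the `IsRiemannForm.*` discharges.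

NOT here: the algebra `B` as an object and Table 1 / Lemma (11) of MZ98 (centre `U_{K_B}`, the factors of
`G_div ⊗ ℂ`); everything after (10).

## References

* [MoonenZarhin1998WeilClasses] B. J. J. Moonen, Yu. G. Zarhin, *Weil classes on abelian varieties*,
  J. reine angew. Math. 496 (1998), (10) (arXiv alg-geom/9612017 p. 2).
* [Lange2023AbelianVarietiesComplex] H. Lange, *Abelian Varieties over the Complex Numbers* (2023), §2.4.2
  Prop. 2.4.12, §7.2.1 Prop. 7.2.3, §7.2.2 Thm. 7.2.4, §7.2.4 Exercise (4).
-/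

noncomputable section

open Complex Function Module Matrix
open Literature.Analysis.Complex

namespace Literature.Geometry.Kaehler

namespace ComplexTorus

variable {ι : Type*} [Fintype ι] [DecidableEq ι] {E : Type*} [NormedAddCommGroup E] [NormedSpace ℂ E]
  (Φ : (ι → ℝ) ≃L[ℝ] E)

/-! ## §0 Plumbing -/

/-- `M_ι(ℚ) → M_ι(ℝ)` is multiplicative. [folklore] -/
private theorem wdc_map_mul (A B : Matrix ι ι ℚ) :
    (A * B).map ((↑) : ℚ → ℝ) = A.map ((↑) : ℚ → ℝ) * B.map ((↑) : ℚ → ℝ) := by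
  have h := RingHom.map_mul (Rat.castHom ℝ).mapMatrix A B
  simpa only [RingHom.mapMatrix_apply, Rat.coe_castHom] using h

/-- `det (G : ℝ) = (det G : ℝ)` for a rational matrix. [folklore] -/
private theorem wdc_det_map (A : Matrix ι ι ℚ) : (A.map ((↑) : ℚ → ℝ)).det = (A.det : ℝ) := by
  have h := RingHom.map_det (Rat.castHom ℝ) A
  rw [RingHom.mapMatrix_apply, Rat.coe_castHom] at h
  exact h.symm

omit [Fintype ι] [DecidableEq ι] in
/-- Composition with a pair. [folklore] -/
private theorem wdc_comp_vecPair {α β : Type*} (f : α → β) (a b : α) : f ∘ ![a, b] = ![f a, f b] := by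
  ext i; fin_cases i <;> rfl

/-! ## §1 Fixing a `2`-class is being symplectic for it -/

/-- **`M ∈ SL(V_ℝ)` fixes the class `E ∈ H²(X, ℝ) ⊂ H²(X, ℂ)` iff `M ∈ Sp(V, E)(ℝ)`** (`ρ(M)^* E = E` iff
`E(M·, M·) = E(·, ·)`). [cite: Lange2023AbelianVarietiesComplex, §7.2.1 (display before Prop. 7.2.3: `Sp(V, E)(ℝ) = {M ∈ SL(V_ℝ) | E(M·, M·) = E(·, ·)}`)]
[cite: MoonenZarhin1998WeilClasses, (10)] -/
theorem compContinuousLinearMap_ofRealForm_eq_iff {η : E [⋀^Fin 2]→L[ℝ] ℝ} {M : SpecialLinearGroup ι ℝ} :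
    (ofRealForm η).compContinuousLinearMap (analyticRepReal Φ Φ M.1) = ofRealForm η ↔ M ∈ spGroup Φ η := by
  rw [mem_spGroup_iff]
  constructor
  · intro h u v
    have huv := congrArg (fun γ : E [⋀^Fin 2]→L[ℝ] ℂ ↦ γ ![u, v]) h
    simp only [ContinuousAlternatingMap.compContinuousLinearMap_apply, ofRealForm_apply, wdc_comp_vecPair] at huv
    exact_mod_cast huv
  · intro h
    ext v
    rw [ContinuousAlternatingMap.compContinuousLinearMap_apply, ofRealForm_apply, ofRealForm_apply]
    have hv : v = ![v 0, v 1] := by ext i; fin_cases i <;> rfl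
    rw [hv, wdc_comp_vecPair, h]

/-- The pointwise stabiliser of the single class `E` is `Sp(V, E)(ℝ)`. [cite: Lange2023AbelianVarietiesComplex, §7.2.1 Prop. 7.2.3]
[cite: MoonenZarhin1998WeilClasses, (10)] -/
theorem formsStabilizer_singleton_ofRealForm (η : E [⋀^Fin 2]→L[ℝ] ℝ) :
    formsStabilizer Φ {ofRealForm η} = spGroup Φ η := by
  ext M
  rw [mem_formsStabilizer_iff]
  simp only [Set.mem_singleton_iff, forall_eq]
  exact compContinuousLinearMap_ofRealForm_eq_iff Φ

/-- **The stabiliser of ALL divisor classes `H²_Hodge(X) = NS_ℚ(X)` (Lefschetz `(1,1)`) is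
`⋂_{E ∈ NS_ℚ(X)} Sp(V, E)(ℝ)`.** [cite: MoonenZarhin1998WeilClasses, (10) ("leaves invariant all divisor classes in `H²(X, ℚ) = ⋀²V`")]
[cite: Lange2023AbelianVarietiesComplex, §7.3.3 Exercise (2)(a) (Lefschetz `(1,1)`)] -/
theorem formsStabilizer_hodgeClasses_one_eq_iInf_spGroup :
    formsStabilizer Φ (hodgeClasses Φ 1 : Set (E [⋀^Fin 2]→L[ℝ] ℂ)) = ⨅ η ∈ neronSeveriQ Φ, spGroup Φ η := by
  ext M
  rw [← map_ofRealFormₗ_neronSeveriQ, Submodule.map_coe, mem_formsStabilizer_iff]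
  simp only [Set.forall_mem_image, ofRealFormₗ_apply, Subgroup.mem_iInf, SetLike.mem_coe,
    compContinuousLinearMap_ofRealForm_eq_iff]

/-! ## §2 `G_div(X)(ℝ) = Gl_B(V)(ℝ) ∩ Sp(V, φ)(ℝ)` -/

/-- **Moonen–Zarhin's `G_div(X) := Gl_B(V) ∩ Sp(V, φ)`** (real points, inside `SL(V_ℝ)`): the elements of
`Sp(V, E₀)(ℝ)` commuting with every `†`-symmetric element `s ∈ S_λ ⊆ End_ℚ(X)` of the polarisation
`L₀ = (E₀ = η₀)` ("the centralizer of `B` in `Sp(V, φ)`", `B` the `ℚ`-algebra generated by `S_λ` —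
centralising `S_λ` is centralising `B`); `S_λ = symmEndRat Φ (ratGram Φ η₀)` (A2-31).
[cite: MoonenZarhin1998WeilClasses, (10)] -/
def divisorClassGroup (η₀ : E [⋀^Fin 2]→L[ℝ] ℝ) : Subgroup (SpecialLinearGroup ι ℝ) :=
  spGroup Φ η₀ ⊓ ⨅ A ∈ symmEndRat Φ (ratGram Φ η₀), matCentralizer A

/-- Membership in `G_div(X)(ℝ)`: symplectic for `E₀` and commuting with every `s ∈ S_λ`.
[cite: MoonenZarhin1998WeilClasses, (10)] -/
theorem mem_divisorClassGroup_iff {η₀ : E [⋀^Fin 2]→L[ℝ] ℝ} {M : SpecialLinearGroup ι ℝ} :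
    M ∈ divisorClassGroup Φ η₀ ↔ M ∈ spGroup Φ η₀ ∧
      ∀ A ∈ symmEndRat Φ (ratGram Φ η₀), M.1 * A.map (Rat.cast : ℚ → ℝ) = A.map (Rat.cast : ℚ → ℝ) * M.1 := by
  rw [divisorClassGroup, Subgroup.mem_inf]
  simp only [Subgroup.mem_iInf, mem_matCentralizer_iff]

/-- `G_div(X) ⊆ Sp(V, φ)`. [cite: MoonenZarhin1998WeilClasses, (10)] -/
theorem divisorClassGroup_le_spGroup (η₀ : E [⋀^Fin 2]→L[ℝ] ℝ) : divisorClassGroup Φ η₀ ≤ spGroup Φ η₀ :=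
  inf_le_left

/-- **`Lf(X) ⊆ G_div(X)`**: the Lefschetz group centralises all of `End_ℚ(X) ⊇ S_λ`.
[cite: MoonenZarhin1998WeilClasses, (10)] [cite: Lange2023AbelianVarietiesComplex, §7.2.4 Exercise (4)] -/
theorem lefschetzGroup_le_divisorClassGroup (η₀ : E [⋀^Fin 2]→L[ℝ] ℝ) :
    lefschetzGroup Φ η₀ ≤ divisorClassGroup Φ η₀ :=
  le_inf (lefschetzGroup_le_spGroup Φ η₀) (le_iInf₂ fun _ hA ↦
    (lefschetzGroup_le_endCentralizer Φ η₀).trans (endCentralizer_le_matCentralizer Φ hA.1))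

/-! ## §3 The divisor classes are the forms `φ_s`, `s ∈ S_λ` -/

section Polarised

variable {Φ} {η₀ : E [⋀^Fin 2]→L[ℝ] ℝ} {G₀ : Matrix ι ι ℚ}

/-- **`G_L = G₀ · φ(L)`** on the lattice basis (`φ(L) = G₀⁻¹ G_L`, A2-31), read over `ℝ`.
[cite: Lange2023AbelianVarietiesComplex, §2.4.2 Prop. 2.4.12] -/
theorem latticeGram_eq_mul_nsToEnd (hG₀ : G₀.map ((↑) : ℚ → ℝ) = latticeGram Φ η₀) (hdet : IsUnit G₀.det)
    (η : neronSeveriQ Φ) :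
    latticeGram Φ (η : E [⋀^Fin 2]→L[ℝ] ℝ) = latticeGram Φ η₀ * (nsToEnd Φ G₀ η).map ((↑) : ℚ → ℝ) := by
  rw [← map_ratGram Φ η.2, ← (transpose_nsToEnd_mul hG₀ hdet η).2, wdc_map_mul, hG₀]

/-- `G_L = ᵗφ(L) · G₀` as well (`φ(L)` is `†`-symmetric). [cite: Lange2023AbelianVarietiesComplex, §2.4.2 Prop. 2.4.12 (proof)] -/
theorem latticeGram_eq_transpose_nsToEnd_mul (hG₀ : G₀.map ((↑) : ℚ → ℝ) = latticeGram Φ η₀)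
    (hdet : IsUnit G₀.det) (η : neronSeveriQ Φ) :
    latticeGram Φ (η : E [⋀^Fin 2]→L[ℝ] ℝ) = ((nsToEnd Φ G₀ η).map ((↑) : ℚ → ℝ))ᵀ * latticeGram Φ η₀ := by
  rw [← map_ratGram Φ η.2, ← (transpose_nsToEnd_mul hG₀ hdet η).1, wdc_map_mul, hG₀, Matrix.transpose_map]

/-- **"the divisor classes, viewed as alternating bilinear forms on `V`, are precisely the forms `φ_s`"**,
right slot: `E_L(u, v) = E₀(u, ρ(φ(L)) v)` for every `L ∈ NS_ℚ(X)`, `φ(L) = φ_{L₀}⁻¹ φ_L ∈ S_λ` (and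
`φ(L)` runs over all of `S_λ`, A2-31 `exists_nsToEnd_eq`). [cite: MoonenZarhin1998WeilClasses, (10)]
[cite: Lange2023AbelianVarietiesComplex, §2.4.2 Prop. 2.4.12] -/
theorem apply_eq_apply_analyticRepReal_nsToEnd (hG₀ : G₀.map ((↑) : ℚ → ℝ) = latticeGram Φ η₀)
    (hdet : IsUnit G₀.det) (η : neronSeveriQ Φ) (u v : E) :
    (η : E [⋀^Fin 2]→L[ℝ] ℝ) ![u, v] =
      η₀ ![u, analyticRepReal Φ Φ ((nsToEnd Φ G₀ η).map ((↑) : ℚ → ℝ)) v] := by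
  obtain ⟨x, rfl⟩ := Φ.surjective u
  obtain ⟨y, rfl⟩ := Φ.surjective v
  rw [analyticRepReal_apply, ← dotProduct_latticeGram_mulVec, ← dotProduct_latticeGram_mulVec,
    latticeGram_eq_mul_nsToEnd hG₀ hdet η, Matrix.mulVec_mulVec]

/-- **The forms `φ_s : (v₁, v₂) ↦ φ(s·v₁, v₂)`, `s ∈ S_λ`**, left slot: `E_L(u, v) = E₀(ρ(φ(L)) u, v)`.
[cite: MoonenZarhin1998WeilClasses, (10) ("`φ_s : (v₁, v₂) ↦ φ(s·v₁, v₂)` for `s ∈ S_λ`")] -/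
theorem apply_eq_apply_analyticRepReal_nsToEnd_left (hG₀ : G₀.map ((↑) : ℚ → ℝ) = latticeGram Φ η₀)
    (hdet : IsUnit G₀.det) (η : neronSeveriQ Φ) (u v : E) :
    (η : E [⋀^Fin 2]→L[ℝ] ℝ) ![u, v] =
      η₀ ![analyticRepReal Φ Φ ((nsToEnd Φ G₀ η).map ((↑) : ℚ → ℝ)) u, v] := by
  obtain ⟨x, rfl⟩ := Φ.surjective u
  obtain ⟨y, rfl⟩ := Φ.surjective v
  rw [analyticRepReal_apply, ← dotProduct_latticeGram_mulVec, ← dotProduct_latticeGram_mulVec,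
    latticeGram_eq_transpose_nsToEnd_mul hG₀ hdet η, ← Matrix.mulVec_mulVec, Matrix.dotProduct_mulVec,
    Matrix.vecMul_transpose]

/-- Every `s ∈ S_λ` is a `φ(L)`: the form `φ_s(u, v) = E₀(ρ(s) u, v)` is a divisor class `E_L`, `L ∈ NS_ℚ(X)`.
[cite: MoonenZarhin1998WeilClasses, (10)] [cite: Lange2023AbelianVarietiesComplex, §2.4.2 Prop. 2.4.12] -/
theorem exists_neronSeveriQ_apply_eq (h₀ : ∀ u v : E, η₀ ![I • u, I • v] = η₀ ![u, v])
    (hG₀ : G₀.map ((↑) : ℚ → ℝ) = latticeGram Φ η₀) (hdet : IsUnit G₀.det) {A : Matrix ι ι ℚ}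
    (hA : A ∈ symmEndRat Φ G₀) :
    ∃ η ∈ neronSeveriQ Φ, ∀ u v : E, η ![u, v] = η₀ ![analyticRepReal Φ Φ (A.map ((↑) : ℚ → ℝ)) u, v] := by
  obtain ⟨η, hη⟩ := exists_nsToEnd_eq h₀ hG₀ hdet hA
  refine ⟨η, η.2, fun u v ↦ ?_⟩
  rw [apply_eq_apply_analyticRepReal_nsToEnd_left hG₀ hdet η, hη]

/-! ## §4 `G_div(X)` is the stabiliser of the divisor classes -/

omit [DecidableEq ι] in
/-- `det(ᵗM G₀) ≠ 0` for `M ∈ SL(V_ℝ)` and `det G₀ ≠ 0`. [folklore] -/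
private theorem wdc_isUnit_det [DecidableEq ι] (hG₀ : G₀.map ((↑) : ℚ → ℝ) = latticeGram Φ η₀) (hdet : IsUnit G₀.det)
    (M : SpecialLinearGroup ι ℝ) : IsUnit (M.1ᵀ * latticeGram Φ η₀).det := by
  rw [Matrix.det_mul, Matrix.det_transpose, M.2, one_mul, ← hG₀, wdc_det_map, isUnit_iff_ne_zero,
    Rat.cast_ne_zero]
  exact fun h ↦ (isUnit_iff_ne_zero.1 hdet) h

/-- **Moonen–Zarhin (10), MAIN: `G_div(X)` "is the largest algebraic subgroup of `Gl(V)` … which leaves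
invariant all divisor classes in `H²(X, ℚ) = ⋀²V`"** — at the level of real points inside `SL(V_ℝ)`: the
pointwise stabiliser of `H²_Hodge(X)` (= the divisor classes, Lefschetz `(1,1)`) IS `G_div(X)(ℝ) =
Gl_B(V)(ℝ) ∩ Sp(V, φ)(ℝ)`. Proof as printed: the divisor classes are the `φ_s`, `s ∈ S_λ`, with Gram
matrices `G₀ s`; `ᵗM G₀ M = G₀` and `ᵗM G₀ s M = G₀ s` for all `s` iff `M ∈ Sp(V, φ)` and `s M = M s` for all `s`.
[cite: MoonenZarhin1998WeilClasses, (10)] -/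
theorem formsStabilizer_hodgeClasses_one_eq_divisorClassGroup (h₀ : ∀ u v : E, η₀ ![I • u, I • v] = η₀ ![u, v])
    (hG₀ : G₀.map ((↑) : ℚ → ℝ) = latticeGram Φ η₀) (hdet : IsUnit G₀.det) :
    formsStabilizer Φ (hodgeClasses Φ 1 : Set (E [⋀^Fin 2]→L[ℝ] ℂ)) = divisorClassGroup Φ η₀ := by
  have hη₀ : η₀ ∈ neronSeveriQ Φ := mem_neronSeveriQ_of_map_eq_latticeGram Φ h₀ hG₀
  have hrat : ratGram Φ η₀ = G₀ := ratGram_eq_of_map_eq h₀ hG₀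
  ext M
  rw [formsStabilizer_hodgeClasses_one_eq_iInf_spGroup, mem_divisorClassGroup_iff, hrat]
  simp only [Subgroup.mem_iInf, mem_spGroup_iff_latticeGram]
  have hP := wdc_isUnit_det hG₀ hdet M
  constructor
  · intro h
    have h1 := h η₀ hη₀
    refine ⟨h1, fun A hA ↦ ?_⟩
    obtain ⟨η, hη⟩ := exists_nsToEnd_eq h₀ hG₀ hdet hA
    have hGA := latticeGram_eq_mul_nsToEnd hG₀ hdet η
    rw [hη] at hGA
    have h2 := h η η.2
    rw [hGA] at h2
    have key : M.1ᵀ * latticeGram Φ η₀ * (A.map ((↑) : ℚ → ℝ) * M.1) =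
        M.1ᵀ * latticeGram Φ η₀ * (M.1 * A.map ((↑) : ℚ → ℝ)) := by
      calc M.1ᵀ * latticeGram Φ η₀ * (A.map ((↑) : ℚ → ℝ) * M.1)
          = M.1ᵀ * (latticeGram Φ η₀ * A.map ((↑) : ℚ → ℝ)) * M.1 := by simp only [Matrix.mul_assoc]
        _ = latticeGram Φ η₀ * A.map ((↑) : ℚ → ℝ) := h2
        _ = M.1ᵀ * latticeGram Φ η₀ * M.1 * A.map ((↑) : ℚ → ℝ) := by rw [h1]
        _ = M.1ᵀ * latticeGram Φ η₀ * (M.1 * A.map ((↑) : ℚ → ℝ)) := by simp only [Matrix.mul_assoc]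
    symm
    calc A.map ((↑) : ℚ → ℝ) * M.1
        = (M.1ᵀ * latticeGram Φ η₀)⁻¹ * (M.1ᵀ * latticeGram Φ η₀ * (A.map ((↑) : ℚ → ℝ) * M.1)) :=
          (Matrix.nonsing_inv_mul_cancel_left _ _ hP).symm
      _ = (M.1ᵀ * latticeGram Φ η₀)⁻¹ * (M.1ᵀ * latticeGram Φ η₀ * (M.1 * A.map ((↑) : ℚ → ℝ))) := by rw [key]
      _ = M.1 * A.map ((↑) : ℚ → ℝ) := Matrix.nonsing_inv_mul_cancel_left _ _ hP
  · rintro ⟨h1, hcomm⟩ η hη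
    have hA := nsToEnd_mem_symmEndRat h₀ hG₀ hdet ⟨η, hη⟩
    have hc := hcomm _ hA
    have hGA := latticeGram_eq_mul_nsToEnd hG₀ hdet ⟨η, hη⟩
    rw [Subtype.coe_mk] at hGA
    rw [hGA]
    calc M.1ᵀ * (latticeGram Φ η₀ * (nsToEnd Φ G₀ ⟨η, hη⟩).map ((↑) : ℚ → ℝ)) * M.1
        = M.1ᵀ * latticeGram Φ η₀ * ((nsToEnd Φ G₀ ⟨η, hη⟩).map ((↑) : ℚ → ℝ) * M.1) := by
          simp only [Matrix.mul_assoc]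
      _ = M.1ᵀ * latticeGram Φ η₀ * (M.1 * (nsToEnd Φ G₀ ⟨η, hη⟩).map ((↑) : ℚ → ℝ)) := by rw [hc]
      _ = M.1ᵀ * latticeGram Φ η₀ * M.1 * (nsToEnd Φ G₀ ⟨η, hη⟩).map ((↑) : ℚ → ℝ) := by
          simp only [Matrix.mul_assoc]
      _ = latticeGram Φ η₀ * (nsToEnd Φ G₀ ⟨η, hη⟩).map ((↑) : ℚ → ℝ) := by rw [h1]

/-- **`Hg(X) ⊆ G_div(X)`**: the Hodge group fixes the Hodge classes, in particular the divisor classes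
(Thm. 7.2.4, Step I). [cite: MoonenZarhin1998WeilClasses, (10)] [cite: Lange2023AbelianVarietiesComplex, §7.2.2 Thm. 7.2.4 (Step I)] -/
theorem hodgeGroup_le_divisorClassGroup (h₀ : ∀ u v : E, η₀ ![I • u, I • v] = η₀ ![u, v])
    (hG₀ : G₀.map ((↑) : ℚ → ℝ) = latticeGram Φ η₀) (hdet : IsUnit G₀.det) :
    hodgeGroup Φ ≤ divisorClassGroup Φ η₀ := by
  rw [← formsStabilizer_hodgeClasses_one_eq_divisorClassGroup h₀ hG₀ hdet]
  exact hodgeGroup_le_formsStabilizer_hodgeClasses Φ 1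

/-- **"The group `G_div(X)` does not depend on the choice of `λ`"**: any two `(1,1)`-forms with rational
invertible Gram matrices (e.g. two polarisations) give the same group — both are the stabiliser of the
divisor classes. [cite: MoonenZarhin1998WeilClasses, (10)] -/
theorem divisorClassGroup_eq {η₁ : E [⋀^Fin 2]→L[ℝ] ℝ} {G₁ : Matrix ι ι ℚ}
    (h₀ : ∀ u v : E, η₀ ![I • u, I • v] = η₀ ![u, v]) (hG₀ : G₀.map ((↑) : ℚ → ℝ) = latticeGram Φ η₀)
    (hdet : IsUnit G₀.det) (h₁ : ∀ u v : E, η₁ ![I • u, I • v] = η₁ ![u, v])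
    (hG₁ : G₁.map ((↑) : ℚ → ℝ) = latticeGram Φ η₁) (hdet₁ : IsUnit G₁.det) :
    divisorClassGroup Φ η₀ = divisorClassGroup Φ η₁ := by
  rw [← formsStabilizer_hodgeClasses_one_eq_divisorClassGroup h₀ hG₀ hdet,
    ← formsStabilizer_hodgeClasses_one_eq_divisorClassGroup h₁ hG₁ hdet₁]

/-! ### "defined over `ℚ`" -/

variable (Φ) in
/-- The equations of `G_div(X)`: the symplectic equations of `G₀` together with the centraliser equations of
every `s ∈ S_λ`. [cite: MoonenZarhin1998WeilClasses, (10) ("the largest algebraic subgroup of `Gl(V)` defined over `ℚ`")] -/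
def divisorClassEqs (G₀ : Matrix ι ι ℚ) : Set (MvPolynomial (ι × ι) ℚ) :=
  symplecticEqs G₀ ∪ ⋃ A ∈ (symmEndRat Φ G₀ : Set (Matrix ι ι ℚ)), centralizerEqs A

variable (Φ) in
/-- The equations of `G_div(X)` define an algebraic `ℚ`-subgroup of `GL(V)`. [cite: MoonenZarhin1998WeilClasses, (10)] -/
theorem isRatAlgSubgroupEqs_divisorClassEqs (G₀ : Matrix ι ι ℚ) : IsRatAlgSubgroupEqs (divisorClassEqs Φ G₀) :=
  (isRatAlgSubgroupEqs_symplecticEqs G₀).union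
    (IsRatAlgSubgroupEqs.biUnion fun A _ ↦ isRatAlgSubgroupEqs_centralizerEqs A)

/-- **`G_div(X)` is defined over `ℚ`**: `divisorClassGroup Φ η₀` is the group of real points of the algebraic
`ℚ`-subgroup cut out by `divisorClassEqs Φ G₀`. [cite: MoonenZarhin1998WeilClasses, (10)] -/
theorem divisorClassGroup_eq_realPoints (h₀ : ∀ u v : E, η₀ ![I • u, I • v] = η₀ ![u, v])
    (hG₀ : G₀.map ((↑) : ℚ → ℝ) = latticeGram Φ η₀) :
    divisorClassGroup Φ η₀ = (isRatAlgSubgroupEqs_divisorClassEqs Φ G₀).realPoints := by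
  ext M
  rw [divisorClassGroup, ratGram_eq_of_map_eq h₀ hG₀, Subgroup.mem_inf, spGroup_eq_realPoints Φ hG₀,
    IsRatAlgSubgroupEqs.mem_realPoints_iff, IsRatAlgSubgroupEqs.mem_realPoints_iff, divisorClassEqs,
    mem_ratZeroLocus_union_iff, mem_ratZeroLocus_biUnion_iff]
  simp only [Subgroup.mem_iInf, matCentralizer, IsRatAlgSubgroupEqs.mem_realPoints_iff, SetLike.mem_coe]

/-! ### Polarised abelian varieties -/

/-- **For a polarised abelian variety `(X, L₀)`: the stabiliser of the divisor classes is `G_div(X)(ℝ)`.**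
[cite: MoonenZarhin1998WeilClasses, (10)] -/
theorem IsRiemannForm.formsStabilizer_hodgeClasses_one_eq (h : IsRiemannForm Φ η₀) :
    formsStabilizer Φ (hodgeClasses Φ 1 : Set (E [⋀^Fin 2]→L[ℝ] ℂ)) = divisorClassGroup Φ η₀ := by
  obtain ⟨G₀, hG₀, hdet⟩ := h.exists_ratMatrix_latticeGram_isUnit
  exact formsStabilizer_hodgeClasses_one_eq_divisorClassGroup h.1 hG₀ hdet

/-- `Hg(X) ⊆ G_div(X) ⊆ Sp(V, φ)` for a polarised abelian variety, and `Lf(X) ⊆ G_div(X)`.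
[cite: MoonenZarhin1998WeilClasses, (10)] -/
theorem IsRiemannForm.hodgeGroup_le_divisorClassGroup (h : IsRiemannForm Φ η₀) :
    hodgeGroup Φ ≤ divisorClassGroup Φ η₀ := by
  rw [← h.formsStabilizer_hodgeClasses_one_eq]
  exact hodgeGroup_le_formsStabilizer_hodgeClasses Φ 1

/-- `G_div(X)` is the same for any two polarisations. [cite: MoonenZarhin1998WeilClasses, (10)] -/
theorem IsRiemannForm.divisorClassGroup_eq {η₁ : E [⋀^Fin 2]→L[ℝ] ℝ} (h : IsRiemannForm Φ η₀)
    (h' : IsRiemannForm Φ η₁) : divisorClassGroup Φ η₀ = divisorClassGroup Φ η₁ := by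
  rw [← h.formsStabilizer_hodgeClasses_one_eq, ← h'.formsStabilizer_hodgeClasses_one_eq]

/-- `G_div(X)` of a polarised abelian variety is (the real points of) an algebraic group defined over `ℚ`.
[cite: MoonenZarhin1998WeilClasses, (10)] -/
theorem IsRiemannForm.exists_divisorClassGroup_eq_realPoints (h : IsRiemannForm Φ η₀) :
    ∃ G₀ : Matrix ι ι ℚ, G₀.map ((↑) : ℚ → ℝ) = latticeGram Φ η₀ ∧
      divisorClassGroup Φ η₀ = (isRatAlgSubgroupEqs_divisorClassEqs Φ G₀).realPoints := by
  obtain ⟨G₀, hG₀, _⟩ := h.exists_ratMatrix_latticeGram_isUnit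
  exact ⟨G₀, hG₀, divisorClassGroup_eq_realPoints h.1 hG₀⟩

end Polarised

end ComplexTorus

end Literature.Geometry.Kaehler
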